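import Summits.HubbardSuperconductivity.HubbardLadder.ClusterCutKernelBits
import Summits.HubbardSuperconductivity.HubbardLadder.ClusterCutKernelRows
import HarnessLib

/-!
# Cluster pair-cuts, kernel certificates §3 + §5: frames from column lists, SPAN, and the per-piece Rayleigh bound

HONEST FRAMING: ladder R1–R4 with certified numbers; no claim on H/H₀.  Cell pub-hubbard, lane r2-eng-1 (g13); design memo
`pub-hubbard-r2-eng-1/psdcert-g12/C-SPEC-g12.md` §7 + `pub-hubbard-r2-eng-1/it4cert-g13/README.md`.  Infrastructure for the cluster
pair-cut road ([C](c) → (d) seam); it certifies no cell by itself.  All statements [folklore].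

§3 `colMat` (the frame matrix of a column list) and `exists_frame_coeffs`: from the SEAM `a • P e_σ = colVec (orbitVec G (code σ))`
and the kernel's `spanOK` over `halfConfs N`, the range of the piece `P` on the weight-zero sector lies in the column span.
§5 `piece_rayleigh_of_kernelCert`: SEAM + representatives + `spanOK` + the row checks of the literal block `Q = c·(B + t·G)` + `Q ⪰ 0`
(from `PsdCert.psdCert` / `psdCertWith`) ⟹ `(−t/4)·‖P v‖² ≤ Re⟨P v, X_P (P v)⟩` on `S^z_tot v = 0` — the per-piece hypothesis `hblk` of
`ClusterCut.rayleigh_ge_of_pieces` (PieceDecomposition), via the block-entry shortcut (`blockEntry_eq` / `gramEntry_eq`, ClusterCutBlocks)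
giving `Φᴴ X_P Φ = (a/4)·B`, `ΦᴴΦ = a·G`, then `rayleigh_ge_of_frame` + `piece_bound_of_frame`.
-/

namespace Summit.HubbardSuperconductivity.HubbardLadder.ClusterCut

open Matrix Literature.MathematicalPhysics.QuantumLattice

/-! ## §3 Frames from column lists; the range of a piece on the weight-zero sector lies in the frame (SPAN) -/

section Frame

variable {N : ℕ}

/-- The frame matrix of a column list: column `l` is `colVec N cols[l]`. [folklore] -/
def colMat (N : ℕ) (cols : List SVec) : Matrix (Fin N → Fin 2) (Fin cols.length) ℂ :=
  fun τ l => colVec N (cols.getD l []) τ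

/-- `Φ c = Σ_l c_l • col_l`. [folklore] -/
theorem colMat_mulVec (cols : List SVec) (c : Fin cols.length → ℂ) :
    colMat N cols *ᵥ c = ∑ l, c l • colVec N (cols.getD l []) := by
  funext τ
  simp only [Matrix.mulVec, dotProduct, colMat, Finset.sum_apply, Pi.smul_apply, smul_eq_mul]
  exact Finset.sum_congr rfl fun l _ => mul_comm _ _

/-- Pointwise-equal evaluations give equal column vectors. [folklore] -/
theorem colVec_eq_of_evalSV {u w : SVec} (h : ∀ τ, evalSV u τ = evalSV w τ) : colVec N u = colVec N w := by
  funext σ; simp only [colVec, h]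

/-- Pointwise-negated evaluations give negated column vectors. [folklore] -/
theorem colVec_eq_neg_of_evalSV {u w : SVec} (h : ∀ τ, evalSV u τ = -evalSV w τ) : colVec N u = -colVec N w := by
  funext σ; simp only [colVec, h, Pi.neg_apply, Int.cast_neg]

/-- Vanishing evaluations give the zero vector. [folklore] -/
theorem colVec_eq_zero_of_evalSV {u : SVec} (h : ∀ τ, evalSV u τ = 0) : colVec N u = 0 := by
  funext σ; simp only [colVec, h, Pi.zero_apply, Int.cast_zero]

/-- `getD` below the length is the element. [folklore] -/
theorem getD_eq_getElem_of_lt {α : Type*} (l : List α) (d : α) {i : ℕ} (h : i < l.length) : l.getD i d = l[i] := by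
  rw [List.getD_eq_getElem?_getD, List.getElem?_eq_getElem h, Option.getD_some]

/-- **SPAN, from the kernel check to the piece**: if `a • P e_σ` is the signed orbit sum of `σ` (the seam), `a ≠ 0`, and the kernel's
`spanOK` holds on all half-filling bitmasks, then on the sector `S^z_tot v = 0` the vector `P v` is a combination of the frame
columns. [folklore] -/
theorem exists_frame_coeffs {Pm : Op (Fin N) 2} {G : List (List ℕ × Bool × ℤ)} {cols : List SVec} {a : ℂ} (ha : a ≠ 0)
    (hseam : ∀ σ : Fin N → Fin 2, a • (Pm *ᵥ Pi.single σ 1) = colVec N (orbitVec N G (encodeBits σ)))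
    (hspan : spanOK N G cols (halfConfs N) = true)
    (v : TensorIndex (Fin N) 2 → ℂ) (hv : (totalSpin 1 2 : Op (Fin N) 2) *ᵥ v = 0) :
    ∃ c : Fin cols.length → ℂ, Pm *ᵥ v = colMat N cols *ᵥ c := by
  let S : Submodule ℂ ((Fin N → Fin 2) → ℂ) :=
    Submodule.span ℂ (Set.range fun l : Fin cols.length => colVec N (cols.getD l []))
  have hcol : ∀ l : Fin cols.length, colVec N (cols.getD l []) ∈ S := fun l => Submodule.subset_span ⟨l, rfl⟩
  have hmem : ∀ σ, v σ • (Pm *ᵥ Pi.single σ 1) ∈ S := by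
    intro σ
    by_cases hσ : v σ = 0
    · rw [hσ, zero_smul]; exact S.zero_mem
    refine S.smul_mem _ ?_
    have hP : Pm *ᵥ Pi.single σ 1 = a⁻¹ • colVec N (orbitVec N G (encodeBits σ)) := by
      rw [← hseam σ, smul_smul, inv_mul_cancel₀ ha, one_smul]
    rw [hP]
    refine S.smul_mem _ ?_
    rcases spanOK_spec hspan (mem_halfConfs_of_weightZero hv hσ) with h0 | ⟨col, hcolmem, hcs⟩
    · rw [colVec_eq_zero_of_evalSV h0]; exact S.zero_mem
    · obtain ⟨l, hl, hlc⟩ := List.getElem_of_mem hcolmem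
      have e : col = cols.getD l [] := by rw [getD_eq_getElem_of_lt cols [] hl, hlc]
      rcases hcs with h1 | h2
      · rw [colVec_eq_of_evalSV h1, e]; exact hcol ⟨l, hl⟩
      · rw [colVec_eq_neg_of_evalSV h2, e]; exact S.neg_mem (hcol ⟨l, hl⟩)
  have hPv : Pm *ᵥ v = ∑ σ, v σ • (Pm *ᵥ Pi.single σ 1) := by
    conv_lhs => rw [← Finset.univ_sum_single v]
    rw [Matrix.mulVec_sum]
    refine Finset.sum_congr rfl fun σ _ => ?_
    rw [← Matrix.mulVec_smul]
    congr 1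
    funext τ
    by_cases h : τ = σ
    · subst h; simp
    · simp [h]
  have hin : Pm *ᵥ v ∈ S := by rw [hPv]; exact S.sum_mem fun σ _ => hmem σ
  obtain ⟨c, hc⟩ := (Submodule.mem_span_range_iff_exists_fun ℂ).mp hin
  exact ⟨c, by rw [← hc, colMat_mulVec]⟩

end Frame

/-! ## §5 From the kernel facts to the per-piece Rayleigh bound -/

section Main

variable {N : ℕ}

open Summit.HubbardSuperconductivity.HubbardLadder.PsdCert (ent)
open scoped ComplexOrder

/-- Entry of a compression `Φᴴ A Φ` as an inner product of columns. [folklore] -/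
theorem conjTranspose_mul_mul_apply {ι m : Type*} [Fintype ι] [Fintype m] (Φ : Matrix ι m ℂ) (A : Matrix ι ι ℂ) (k l : m) :
    (Φᴴ * A * Φ) k l = star (fun τ => Φ τ k) ⬝ᵥ (A *ᵥ fun τ => Φ τ l) := by
  rw [Matrix.mul_assoc]
  simp only [Matrix.mul_apply, Matrix.conjTranspose_apply, Matrix.mulVec, dotProduct, Pi.star_apply]

/-- Entry of a Gram matrix `Φᴴ Φ` as an inner product of columns. [folklore] -/
theorem conjTranspose_mul_self_apply {ι m : Type*} [Fintype ι] [Fintype m] (Φ : Matrix ι m ℂ) (k l : m) :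
    (Φᴴ * Φ) k l = star (fun τ => Φ τ k) ⬝ᵥ (fun τ => Φ τ l) := by
  simp only [Matrix.mul_apply, Matrix.conjTranspose_apply, dotProduct, Pi.star_apply]

/-- `encodeBits (decodeBits N r) = r` for `r < 2^N`. [folklore] -/
theorem encodeBits_decodeBits {r : ℕ} (hr : r < 2 ^ N) : encodeBits (decodeBits N r) = r := by
  have h := decodeBits_eq_symm (N := N) ⟨r, hr⟩
  simp only at h
  rw [h, encodeBits_eq, Equiv.apply_symm_apply]

/-- A nonnegative real multiple of a positive semidefinite complex matrix is positive semidefinite. [folklore] -/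
theorem posSemidef_real_smul {m : Type*} [Fintype m] {M : Matrix m m ℂ} (hM : M.PosSemidef) {r : ℝ} (hr : 0 ≤ r) :
    (((r : ℝ) : ℂ) • M).PosSemidef := by
  refine Matrix.PosSemidef.of_dotProduct_mulVec_nonneg ?_ fun x => ?_
  · rw [Matrix.IsHermitian, Matrix.conjTranspose_smul, hM.1.eq, Complex.star_def, Complex.conj_ofReal]
  · rw [Matrix.smul_mulVec, dotProduct_smul]
    exact smul_nonneg (Complex.zero_le_real.mpr hr) (hM.dotProduct_mulVec_nonneg x)

/-- **Per-piece Rayleigh bound from the kernel certificate.**  Data: a `pairsOK` integer pair list `P` on `N` sites (`X₀ = pairOp P`),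
a piece `Pm` (Hermitian, idempotent on vectors, commuting with `X₀`) whose scaled basis images `a • Pm e_σ` are the signed orbit sums
`orbitVec N G (code σ)` (the SEAM), representatives `reps` (bitmasks `< 2^N`), the columns `cols = reps.map (orbitVec N G)` with keys
`< 2^N`, and a literal integer block `Q`.  Kernel facts: `spanOK` on all half-filling bitmasks, the row checks
`Q[k][l] = bmatEntry P reps[k] cols[l] + t · gmatEntry reps[k] cols[l]`, and `Q ⪰ 0` (from `psdCert` / `psdCertWith`).  Conclusion: on the
sector `S^z_tot v = 0`, `(−t/4)·‖Pm v‖² ≤ Re⟨Pm v, X₀ Pm v⟩` — the hypothesis `hblk` of `rayleigh_ge_of_pieces` for this piece, up to the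
cut's scaling (`c > 0` is the literal scale of `Q = c·(B + t·G)`).  Proof: `Φᴴ X₀ Φ = (a/4)·B`, `ΦᴴΦ = a·G` by the block-entry shortcut,
so `Φᴴ X₀ Φ + (t/4) ΦᴴΦ = (a/(4c))·Q ⪰ 0`, then `rayleigh_ge_of_frame` + `piece_bound_of_frame` with the span lemma. [folklore] -/
theorem piece_rayleigh_of_kernelCert (hN : 0 < N) (P : NatPairList) (hP : pairsOK N P = true)
    {Pm : Op (Fin N) 2} (hherm : Pmᴴ = Pm) (hidem : ∀ w, Pm *ᵥ (Pm *ᵥ w) = Pm *ᵥ w)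
    (hPX : Pm * pairOp (toPairList N P hN) = pairOp (toPairList N P hN) * Pm)
    {G : List (List ℕ × Bool × ℤ)} {a : ℕ} (ha : 0 < a)
    (hseam : ∀ σ : Fin N → Fin 2, (a : ℂ) • (Pm *ᵥ Pi.single σ 1) = colVec N (orbitVec N G (encodeBits σ)))
    {reps : List ℕ} {cols : List SVec} {Q : List (List ℤ)} {c : ℕ} (hc : 0 < c) {t : ℤ}
    (hreps : (reps.all fun r => decide (r < 2 ^ N)) = true) (hcols : cols = reps.map (orbitVec N G))
    (hkeys : (cols.all fun col => keysLT N col) = true) (hspan : spanOK N G cols (halfConfs N) = true)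
    (hq : qRowsOK P c t cols reps Q = true)
    (hpsd : (Matrix.of fun i j : Fin cols.length => (ent Q i j : ℝ)).PosSemidef) :
    ∀ v : TensorIndex (Fin N) 2 → ℂ, (totalSpin 1 2 : Op (Fin N) 2) *ᵥ v = 0 →
      (-(t : ℝ) / 4) * (star (Pm *ᵥ v) ⬝ᵥ (Pm *ᵥ v)).re ≤
        (star (Pm *ᵥ v) ⬝ᵥ pairOp (toPairList N P hN) *ᵥ (Pm *ᵥ v)).re := by
  intro v hv
  set X0 : Op (Fin N) 2 := pairOp (toPairList N P hN) with hX0def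
  have hPne := pairsOK_ne hP
  have ha' : (a : ℂ) ≠ 0 := Nat.cast_ne_zero.mpr (Nat.pos_iff_ne_zero.mp ha)
  -- lengths
  have hlen : cols.length = reps.length := by rw [hcols, List.length_map]
  obtain ⟨hQlen, hQrows⟩ := qRowsOK_spec reps Q hq
  -- per-column facts
  have hrep : ∀ k : Fin cols.length, reps.getD k 0 < 2 ^ N := by
    intro k
    have hk : (k : ℕ) < reps.length := hlen ▸ k.isLt
    rw [getD_eq_getElem_of_lt reps 0 hk]
    simp only [List.all_eq_true, decide_eq_true_eq] at hreps
    exact hreps _ (List.getElem_mem hk)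
  have hcolk : ∀ k : Fin cols.length, cols.getD k [] = orbitVec N G (reps.getD k 0) := by
    intro k
    have hk : (k : ℕ) < reps.length := hlen ▸ k.isLt
    rw [getD_eq_getElem_of_lt cols [] k.isLt, getD_eq_getElem_of_lt reps 0 hk]
    simp only [hcols, List.getElem_map]
  have hkey : ∀ k : Fin cols.length, keysLT N (cols.getD k []) = true := by
    intro k
    rw [getD_eq_getElem_of_lt cols [] k.isLt]
    simp only [List.all_eq_true] at hkeys
    exact hkeys _ (List.getElem_mem k.isLt)
  -- the seam on the representatives: column k = a • Pm e_{σ_k}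
  have hcol : ∀ k : Fin cols.length,
      colVec N (cols.getD k []) = (a : ℂ) • (Pm *ᵥ Pi.single (decodeBits N (reps.getD k 0)) 1) := by
    intro k
    rw [hseam, encodeBits_decodeBits (hrep k), hcolk k]
  have hw : ∀ k : Fin cols.length, Pm *ᵥ colVec N (cols.getD k []) = colVec N (cols.getD k []) := by
    intro k
    rw [hcol k, Matrix.mulVec_smul, hidem]
  -- entries of the compression and of the Gram matrix
  have hB : ∀ k l : Fin cols.length, (((colMat N cols)ᴴ * X0 * colMat N cols) k l : ℂ) =
      (a : ℂ) / 4 * ((bmatEntry P (reps.getD k 0) (cols.getD l []) : ℤ) : ℂ) := by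
    intro k l
    rw [conjTranspose_mul_mul_apply]
    change star (colVec N (cols.getD k [])) ⬝ᵥ (X0 *ᵥ colVec N (cols.getD l [])) = _
    rw [hcol k, blockEntry_eq hherm hPX (hw l) (a : ℂ) (decodeBits N (reps.getD k 0)), Complex.conj_natCast,
      bmatEntry_eq P hN hP (hrep k) (cols.getD l []) (hkey l)]
    ring
  have hGm : ∀ k l : Fin cols.length, (((colMat N cols)ᴴ * colMat N cols) k l : ℂ) =
      (a : ℂ) * ((gmatEntry (reps.getD k 0) (cols.getD l []) : ℤ) : ℂ) := by
    intro k l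
    rw [conjTranspose_mul_self_apply]
    change star (colVec N (cols.getD k [])) ⬝ᵥ (colVec N (cols.getD l [])) = _
    rw [hcol k, gramEntry_eq hherm (hw l) (a : ℂ) (decodeBits N (reps.getD k 0)), Complex.conj_natCast,
      gmatEntry_eq (hrep k)]
  -- entries of Q from the row checks
  have hQ : ∀ k l : Fin cols.length, ent Q k l =
      c * (bmatEntry P (reps.getD k 0) (cols.getD l []) + t * gmatEntry (reps.getD k 0) (cols.getD l [])) := by
    intro k l
    have hk : (k : ℕ) < reps.length := hlen ▸ k.isLt
    obtain ⟨_, hrow⟩ := qRowOK_spec hPne (hQrows k hk)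
    exact hrow l l.isLt
  -- the compressed matrix identity
  have hM : (colMat N cols)ᴴ * (((1 : ℝ) : ℂ) • X0) * colMat N cols - (((-(t : ℝ) / 4 : ℝ)) : ℂ) • ((colMat N cols)ᴴ * colMat N cols)
      = ((((a : ℝ) / (4 * c) : ℝ)) : ℂ) • ((Matrix.of fun i j : Fin cols.length => ent Q i j).map (Int.cast : ℤ → ℂ)) := by
    have hc' : (c : ℂ) ≠ 0 := Nat.cast_ne_zero.mpr (Nat.pos_iff_ne_zero.mp hc)
    ext k l
    rw [Complex.ofReal_one, one_smul, Matrix.sub_apply, Matrix.smul_apply, Matrix.smul_apply, Matrix.map_apply,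
      Matrix.of_apply, hB, hGm, hQ]
    simp only [smul_eq_mul]
    push_cast
    field_simp
    ring
  -- positivity of the compressed matrix
  have hpsdC : ((colMat N cols)ᴴ * (((1 : ℝ) : ℂ) • X0) * colMat N cols
      - (((-(t : ℝ) / 4 : ℝ)) : ℂ) • ((colMat N cols)ᴴ * colMat N cols)).PosSemidef := by
    rw [hM]
    refine posSemidef_real_smul ?_ (by positivity)
    exact posSemidef_map_intCast_complex (Q := Matrix.of fun i j : Fin cols.length => ent Q i j) hpsd
  -- frame bound, then the piece bound
  have hframe : ∀ c : Fin cols.length → ℂ,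
      (-(t : ℝ) / 4) * (star (colMat N cols *ᵥ c) ⬝ᵥ (colMat N cols *ᵥ c)).re ≤
        (star (colMat N cols *ᵥ c) ⬝ᵥ X0 *ᵥ (colMat N cols *ᵥ c)).re := by
    intro c
    have h := rayleigh_ge_of_frame (X := X0) (colMat N cols) (k := 1) (σ := -(t : ℝ) / 4) one_pos hpsdC c
    rwa [div_one] at h
  exact piece_bound_of_frame Pm (colMat N cols) (exists_frame_coeffs ha' hseam hspan) hframe v hv

end Main
end Summit.HubbardSuperconductivity.HubbardLadder.ClusterCut
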